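import Mathlib
import HarnessLib
import Summits.NavierStokesRegularity.NavierStokesRegularity.Theorems.PoloidalWindowDoorLrcModEntireFlatCurtain
import Summits.NavierStokesRegularity.NavierStokesRegularity.Theorems.PoloidalWindowDoorLrcModEntireWeightSourceTranslate

/-!
# Route `PoloidalWindowDoor`, item `LrcModEntire` (stmt-NavierStokesRegularity-20428), cell (Q4-curved), v17 child `stub_Q4curvedAperiodicVerticalFlatLimit` —
# H7b: THE WINDOW KILL — a flat vertical critical curtain through ALL heights + a proportional-shear height window with non-zero slope ⇒ the class profile is trivial

Cell ns-regularity-ideate, stub-worker seat ns-poloidal-K2-p2 g19 under the LEAD of item 20428 (ns-poloidal-K2-p3 g18); `--supports stmt-NavierStokesRegularity-20428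
--as helper`.  This is the second half (H7b) of the lemma `false_of_flatCurtain_anywhere` of the v17 closer chain (LEAD's cut 03:19:38Z / 03:21:43Z): the first half
H7a `…Q4CurvedSlopeWindow.slopeWindow_of_nonzero` (LEAD) produces, for a non-trivial (TH) class profile, a height window `(c₀ − η, c₀ + η)` on which the time `−1`
slice obeys the proportional-shear law `∂₂W_b = μ(y₂)·∂_bW₂` (`b` horizontal) with `μ ≠ 0`; this file kills such a profile when its time `−1` slice ALSO carries a FLAT
vertical critical curtain `{p + s·e + z·e₂ : s, z ∈ ℝ}` (`e` horizontal, `e ≠ 0`) on which the horizontal gradient of `W₂(−1,·)` vanishes: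

* ★ `false_of_flatCurtain_slopeWindow` — class quintuple (Type-I decay, continuity, Oseen-mild, div-free, poloidal) + slope window + flat curtain + `W ≢ 0` ⊢ `False`.

Proof (all tree): translate by `a := c₀·e₂` (`…WeightSourceTranslate.class_translate` / `poloidal_translate`; the window becomes `|y₂| < η`, the curtain keeps its
shape with base point `p − a` because it contains all heights); normalise `e` to the unit `e′ := ‖e‖⁻¹·e` and write the curtain as the web sheet
`webMap e′ (fun _ => c)` with `c := ⟪p − a, Je′⟫` (`…GraphSheetUniqueness.decomp_graphFrame`); the slice law `∂₂²θ = −μ·Δₕθ` for `θ := W₂(−1, · + a)` on the slab from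
`…TimeHeightShearLinearSlice.plane_wave_identity`; then K2-p2 g18's ★`…FlatCurtain.fderiv_apply_eq_zero_of_flatCurtain` (analytic Cauchy uniqueness across the
NON-CHARACTERISTIC plane, `μ ≠ 0`) gives `∂_{e′}θ ≡ 0` on `ℝ³`, and the horizontal-germ Liouville theorem `…HorizontalGerm.eq_zero_of_horizontalDeriv_two_eq_zero`
(K2-p3 g16 / port-2 g7) gives `W(·, · + a) ≡ 0`, contradicting `W ≢ 0`.

WHAT THIS IS NOT: not a claim about Navier–Stokes regularity; one helper lemma of the closer of ONE registered research slot (`stub_Q4curvedAperiodicVerticalFlatLimit`,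
twist_split v17); items 20428 / 19708 / 27893 OPEN (bears_on LADDER-NS N0).
-/

noncomputable section

set_option linter.dupNamespace false
set_option linter.style.longLine false

namespace Summit.NavierStokesRegularity.NavierStokesRegularity.Theorems.PoloidalWindowDoorLrcModEntireQ4CurvedFlatCurtainWindow

open Set Function Filter Topology Metric
open scoped InnerProductSpace RealInnerProductSpace ContDiff
open Literature.Analysis Literature.Analysis.FluidPDE Literature.Analysis.UnboundedOperators
open Summit.NavierStokesRegularity.NavierStokesRegularity.Theorems.PoloidalWindowDoorLrcModEntireSheetFlattenTools
open Summit.NavierStokesRegularity.NavierStokesRegularity.Theorems.PoloidalWindowDoorLrcModEntireParallelWebsIdentity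
open Summit.NavierStokesRegularity.NavierStokesRegularity.Theorems.PoloidalWindowDoorLrcModEntireRidgeGlobalBranchFrame
open Summit.NavierStokesRegularity.NavierStokesRegularity.Theorems.PoloidalWindowDoorLrcModEntireGraphSheetUniqueness
open Summit.NavierStokesRegularity.NavierStokesRegularity.Theorems.PoloidalWindowDoorLrcModEntireHorizontalGerm
open Summit.NavierStokesRegularity.NavierStokesRegularity.Theorems.PoloidalWindowDoorLrcModEntireFlatCurtain
open Summit.NavierStokesRegularity.NavierStokesRegularity.Theorems.PoloidalWindowDoorLrcModEntireWeightSourceTranslate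
open Summit.NavierStokesRegularity.NavierStokesRegularity.Theorems.PoloidalWindowDoorPoloidalWindowRigidityTimeHeightShearLinearSlice
open Summit.NavierStokesRegularity.NavierStokesRegularity.Theorems.PoloidalWindowDoorPoloidalWindowRigidityConstantShearSlice
open Summit.NavierStokesRegularity.NavierStokesRegularity.Theorems.LocalSineTubeDoorProfileAlignedWindowRigidityAncient

/-- ★ **H7b — THE WINDOW KILL.**  A profile of the route's Type-I class (decay rate, continuity, Oseen-mild identity, divergence-free, poloidal) whose time `−1`
slice (i) obeys the proportional-shear law `∂₂W_b(y) = μ(y₂)·∂_bW₂(y)` (`b ≠ 2`) with `μ ≠ 0` for all `y` in the height window `y₂ ∈ (c₀ − η, c₀ + η)` and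
(ii) is horizontally critical in its vertical component on the whole flat vertical curtain `{p + s·e + z·e₂ : s, z ∈ ℝ}` (`e₂ = 0`-component of `e`, `e ≠ 0`),
is identically zero — contradicting `W ≢ 0`.  See the module docstring for the proof. -/
theorem false_of_flatCurtain_slopeWindow {C : ℝ} {W : ℝ → EuclideanSpace ℝ (Fin 3) → EuclideanSpace ℝ (Fin 3)}
    (hrate : HasTypeITimeDecay C W) (hcont : ContinuousOn (uncurry W) (Iio (0 : ℝ) ×ˢ univ))
    (hmild : ∀ s t : ℝ, s < t → t < 0 → ∀ x, W t x = heatExtension (W s) (t - s) x - oseenDuhamel 1 s W W t x)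
    (hdiv : ∀ t < 0, VectorCalculus.IsDivFree (W t))
    (hpol : ∀ s < 0, ∀ q, ⟪curl (W s) q, EuclideanSpace.single 2 1⟫_ℝ = 0)
    {c₀ η : ℝ} (hη : 0 < η) {μ : ℝ → ℝ} (hμ : ∀ z ∈ Ioo (c₀ - η) (c₀ + η), μ z ≠ 0)
    (hslope : ∀ y : EuclideanSpace ℝ (Fin 3), y 2 ∈ Ioo (c₀ - η) (c₀ + η) → ∀ b : Fin 3, b ≠ 2 →
      fderiv ℝ (W (-1)) y (EuclideanSpace.single 2 1) b = μ (y 2) * fderiv ℝ (W (-1)) y (EuclideanSpace.single b 1) 2)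
    {p e : EuclideanSpace ℝ (Fin 3)} (he2 : e 2 = 0) (he : e ≠ 0)
    (hcurt : ∀ s z : ℝ, ∀ w : EuclideanSpace ℝ (Fin 3), w 2 = 0 →
      fderiv ℝ (fun y => W (-1) y 2) (p + s • e + z • EuclideanSpace.single 2 (1 : ℝ)) w = 0)
    (hne : ∃ t < 0, ∃ x, W t x ≠ 0) : False := by
  have hs : (-1 : ℝ) < 0 := by norm_num
  -- (1) translate by `a := c₀ • e₂`
  set a : EuclideanSpace ℝ (Fin 3) := c₀ • EuclideanSpace.single 2 (1 : ℝ) with ha_def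
  have ha2 : a 2 = c₀ := by simp [ha_def]
  obtain ⟨hrate', hcont', hmild', hdiv'⟩ := class_translate hrate hcont hmild hdiv a
  have hpol' := poloidal_translate hpol a
  set V : ℝ → EuclideanSpace ℝ (Fin 3) → EuclideanSpace ℝ (Fin 3) := fun t y => W t (y + a) with hV_def
  -- the slope law of the translate on the centred window `|y₂| < η`, slope `μ′ z := μ (z + c₀)`
  set μ' : ℝ → ℝ := fun z => μ (z + c₀) with hμ'_def
  have hplane : ∀ z : ℝ, z ∈ Ioo (-η) η → ∀ y : EuclideanSpace ℝ (Fin 3), y 2 = z → ∀ b : Fin 3, b ≠ 2 →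
      fderiv ℝ (V (-1)) y (EuclideanSpace.single 2 (1 : ℝ)) b = μ' z * fderiv ℝ (V (-1)) y (EuclideanSpace.single b (1 : ℝ)) 2 := by
    intro z hz y hy b hb
    have hya : (y + a) 2 = z + c₀ := by
      show y 2 + a 2 = z + c₀
      rw [ha2, hy]
    have hmem : (y + a) 2 ∈ Ioo (c₀ - η) (c₀ + η) := by
      rw [hya]; exact ⟨by linarith [hz.1], by linarith [hz.2]⟩
    have h := hslope (y + a) hmem b hb
    rw [hya] at h
    show fderiv ℝ (fun x => W (-1) (x + a)) y (EuclideanSpace.single 2 (1 : ℝ)) b =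
      μ (z + c₀) * fderiv ℝ (fun x => W (-1) (x + a)) y (EuclideanSpace.single b (1 : ℝ)) 2
    rw [fderiv_comp_add_right]
    exact h
  have hslope' : ∀ y : EuclideanSpace ℝ (Fin 3), |y 2| < η → ∀ b : Fin 3, b ≠ 2 →
      fderiv ℝ (V (-1)) y (EuclideanSpace.single 2 1) b = μ' (y 2) * fderiv ℝ (V (-1)) y (EuclideanSpace.single b 1) 2 :=
    fun y hy b hb => hplane (y 2) ⟨by linarith [(abs_lt.1 hy).1], (abs_lt.1 hy).2⟩ y rfl b hb
  have hμ' : ∀ z ∈ Ioo (-η) η, μ' z ≠ 0 := fun z hz => hμ (z + c₀) ⟨by linarith [hz.1], by linarith [hz.2]⟩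
  -- (2) analyticity of the translated slice and the slice law `∂₂²θ = −μ′·Δₕθ` on the slab `{y₂ ∈ (−η, η)}`
  have hVan : AnalyticOnNhd ℝ (V (-1)) univ := analyticOnNhd_slice hcont' (bdd_of_hasTypeITimeDecay hrate') hmild' hs
  have hV2 : ContDiff ℝ 2 (V (-1)) := hVan.contDiff
  have hθan : AnalyticOnNhd ℝ (fun y => V (-1) y 2) univ := fun y _ =>
    ((EuclideanSpace.proj (2 : Fin 3) : EuclideanSpace ℝ (Fin 3) →L[ℝ] ℝ).analyticAt _).comp (hVan y (mem_univ _))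
  have hlaw : ∀ x : EuclideanSpace ℝ (Fin 3), x 2 ∈ Ioo (-η) η →
      fderiv ℝ (fun y => fderiv ℝ (fun y' => V (-1) y' 2) y (EuclideanSpace.single 2 (1 : ℝ))) x (EuclideanSpace.single 2 (1 : ℝ)) =
        -μ' (x 2) * (fderiv ℝ (fun y => fderiv ℝ (fun y' => V (-1) y' 2) y (EuclideanSpace.single 0 (1 : ℝ))) x (EuclideanSpace.single 0 (1 : ℝ)) +
          fderiv ℝ (fun y => fderiv ℝ (fun y' => V (-1) y' 2) y (EuclideanSpace.single 1 (1 : ℝ))) x (EuclideanSpace.single 1 (1 : ℝ))) :=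
    fun x hx => plane_wave_identity hV2 (fun y => div_coord (hdiv' _ hs) y) (hplane (x 2) hx) rfl
  -- (3) the unit direction `e′ := ‖e‖⁻¹ • e` and the curtain as the web sheet `webMap e′ (fun _ => c)`, `c := ⟪p − a, Je′⟫`
  have hne0 : ‖e‖ ≠ 0 := norm_ne_zero_iff.2 he
  have hnpos : 0 < ‖e‖ := norm_pos_iff.2 he
  set e' : EuclideanSpace ℝ (Fin 3) := ‖e‖⁻¹ • e with he'_def
  have he2' : e' 2 = 0 := by simp [he'_def, he2]
  have hun' : ‖e'‖ = 1 := by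
    rw [he'_def, norm_smul, norm_inv, norm_norm, inv_mul_cancel₀ hne0]
  have he'ne : e' ≠ 0 := by
    intro h; rw [h, norm_zero] at hun'; exact zero_ne_one hun'
  set p' : EuclideanSpace ℝ (Fin 3) := p - a with hp'_def
  set c : ℝ := ⟪p', rotJ e'⟫ with hc_def
  have hJv : Jvec e' = rotJ e' := rfl
  -- every sheet point, translated back by `a`, is a curtain point `p + s•e + z•e₂`
  have hpt : ∀ q : ℝ × ℝ, webMap e' (fun _ => c) q + a =
      p + ((q.1 - ⟪p', e'⟫) * ‖e‖⁻¹) • e + (q.2 - p' 2) • EuclideanSpace.single 2 (1 : ℝ) := by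
    intro q
    have hdec := decomp_graphFrame he2' hun' 0 0 p'
    simp only [add_zero, zero_mul, sub_zero, zero_smul, zero_add] at hdec
    -- `p' = ⟪p',e'⟫•e' + p'₂•e₂ + ⟪p',Je'⟫•Je'`
    have hp : p = a + (⟪p', e'⟫ • e' + (p' 2) • e2 + c • rotJ e') := by
      rw [← hdec, hp'_def]; abel
    have hse : ((q.1 - ⟪p', e'⟫) * ‖e‖⁻¹) • e = (q.1 - ⟪p', e'⟫) • e' := by
      rw [he'_def, smul_smul]
    rw [hse, hp]
    simp only [webMap, hJv, e2]
    simp only [sub_smul]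
    abel
  have hcurt' : ∀ q ∈ region (Ioo (-η) η), ∀ w : EuclideanSpace ℝ (Fin 3), w 2 = 0 →
      fderiv ℝ (fun y => V (-1) y 2) (webMap e' (fun _ => c) q) w = 0 := by
    intro q _ w hw
    have hcomp : fderiv ℝ (fun y : EuclideanSpace ℝ (Fin 3) => W (-1) (y + a) 2) (webMap e' (fun _ => c) q) =
        fderiv ℝ (fun y' : EuclideanSpace ℝ (Fin 3) => W (-1) y' 2) (webMap e' (fun _ => c) q + a) :=
      fderiv_comp_add_right (f := fun y' : EuclideanSpace ℝ (Fin 3) => W (-1) y' 2) a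
    show fderiv ℝ (fun y => W (-1) (y + a) 2) (webMap e' (fun _ => c) q) w = 0
    rw [hcomp, hpt q]
    exact hcurt _ _ w hw
  -- (4) Cauchy uniqueness across the non-characteristic plane: `∂_{e′} V₂(−1,·) ≡ 0` on `ℝ³`
  have hz := fderiv_apply_eq_zero_of_flatCurtain (μ := μ') (I := Ioo (-η) η) hθan isOpen_Ioo (nonempty_Ioo.2 (by linarith)) hμ' he2' hun' c hlaw hcurt'
  -- (5) the horizontal-germ Liouville theorem: the translate vanishes, hence so does `W`
  have hzero := eq_zero_of_horizontalDeriv_two_eq_zero hrate' hcont' hmild' hdiv' hpol' hη hslope' he'ne he2' (fun x _ => hz x)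
  obtain ⟨t, ht, x, hx⟩ := hne
  apply hx
  have h := hzero t ht (x - a)
  simpa [hV_def] using h

end Summit.NavierStokesRegularity.NavierStokesRegularity.Theorems.PoloidalWindowDoorLrcModEntireQ4CurvedFlatCurtainWindow

end
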